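import Literature.AnabelianGeometry.SemiGraphs.SurfaceTypeModels
import Literature.AnabelianGeometry.SemiGraphs.ProSigmaCompletionProfiniteExtend
import Literature.GroupTheory.CombinatorialGroupTheory.PuncturedSurfaceGroupCuspBases
import HarnessLib

/-!
# A LOOP model of "semi-graph of anabelioids of surface type" ([SemiAnbd] Example 2.10)

Mochizuki, *Semi-graphs of anabelioids*, Publ. RIMS **42** (2006) 221–322, Example 2.10 p. 31
[cite: MochizukiSemiAnbd2006, Ex. 2.10 p.31]: the semi-graph of anabelioids of a pointed stable curve
has a LOOP (a closed edge both of whose branches abut to the same vertex) at every node lying on a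
single irreducible component; the two branches are attached through the inertia groups of the two
DISTINCT cusps of the normalisation over the node.  `SurfaceTypeModels.lean` (smooth curve) and
`SurfaceTypeNodalModels.lean` (two components meeting in a node) have no loop.  This proof-only file
builds the loop case through the bridge `ProfiniteSemiGraph.isOfSurfaceType_toAnab`: the dual
semi-graph of the irreducible stable curve obtained from a smooth `(k+2)`-pointed curve of genus `g`
by identifying its first two marked points —

* one vertex `v` with group a pro-`Σ` completion `ι : Γ_{g,k+2} → P`;
* one closed edge `e` (the node), a loop at `v`, with group `Ī₀ = closure ι(⟨c₀⟩)`; one branch is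
  the inclusion `Ī₀ ⊆ P`, the other is `σ̂|Ī₀`, where `σ̂ : P ≃ P` is the continuous automorphism
  extending a "cusp-braiding" automorphism `σ` of `Γ_{g,k+2}` with `σ(c₀) = c₁`
  (`PuncturedSurfaceGroupCuspBases`: Tietze eliminations of `c₀`, resp. `c₁`), so that its image is
  `σ̂(Ī₀) = Ī₁` — the node is attached through cusps `0` and `1`;
* `k` open edges (the remaining marked points) with groups `Ī_{j+2}`;

of injective type, connected, every edge abutting to the vertex, a graph when `k = 0`, and of
surface type (`exists_isOfSurfaceType_loop`).  On the way: `IsProSigmaCompletion` is stable under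
automorphisms of the SOURCE (`IsProSigmaCompletion.comp_mulEquiv`), and a pro-`Σ` completion of
`Γ_{g,k+2}` carries a continuous automorphism moving `Ī₀` onto `Ī₁`
(`exists_continuousMulEquiv_map_cuspInertia_zero_eq_one`).

A model certifies satisfiability only; nothing here takes a side on [IUTchIII] Cor. 3.12.
Theorems only.
-/

noncomputable section

namespace Literature.AnabelianGeometry.SemiGraphs

open CategoryTheory
open Literature.AnabelianGeometry.Anabelioids
open Literature.GroupTheory.CombinatorialGroupTheory
open scoped Pointwise Topology

universe u

namespace SemiGraphOfAnabelioids.IsProSigmaCompletion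

variable {Sigma : Set ℕ} {Γ Γ' : Type*} [Group Γ] [Group Γ'] {P : Type*} [Group P]
  [TopologicalSpace P] {ι : Γ →* P}

/-- **Transport of `IsProSigmaCompletion` along an isomorphism of the SOURCE**: if `ι : Γ → P` is a
pro-`Σ` completion and `e : Γ' ≅ Γ`, then `ι ∘ e : Γ' → P` is a pro-`Σ` completion (same image;
normal subgroups of `Σ`-integer index correspond under `e`). [cite: MochizukiSemiAnbd2006, Ex. 2.10 p.31] -/
theorem comp_mulEquiv (hι : IsProSigmaCompletion Sigma ι) (e : Γ' ≃* Γ) :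
    IsProSigmaCompletion Sigma (ι.comp e.toMonoidHom) where
  dense := by
    have : Set.range (ι.comp e.toMonoidHom) = Set.range ι := by
      change Set.range (ι ∘ e) = Set.range ι
      exact e.surjective.range_comp ι
    rw [this]
    exact hι.dense
  index_open := hι.index_open
  comap_surj N hN hidx := by
    haveI := hN
    let N' : Subgroup Γ := N.comap e.symm.toMonoidHom
    haveI : N'.Normal := Subgroup.Normal.comap hN _
    have hidx' : Anabelioids.IsSigmaInteger Sigma N'.index := by
      rwa [Subgroup.index_comap_of_surjective _ e.symm.surjective]
    obtain ⟨U, hUo, hU⟩ := hι.comap_surj N' inferInstance hidx'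
    refine ⟨U, hUo, ?_⟩
    rw [← Subgroup.comap_comap, hU]
    ext x
    simp only [N', Subgroup.mem_comap, MulEquiv.coe_toMonoidHom, MulEquiv.symm_apply_apply]

end SemiGraphOfAnabelioids.IsProSigmaCompletion

namespace ProfiniteSemiGraph

/-- **A pro-`Σ` completion of `Γ_{g,k+2}` has a continuous automorphism carrying the closed
inertia group of cusp `0` onto that of cusp `1`** (and `ι(c₀)` to `ι(c₁)`): extend the automorphism
`σ = e₂ ∘ e₁⁻¹` of `Γ_{g,k+2}` (`e₁`, `e₂` the free bases of `PuncturedSurfaceGroupCuspBases`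
eliminating `c₀`, resp. `c₁`, both sending the kept first cusp generator to the same letter) by the
universal property of pro-`Σ` completions. [cite: MochizukiSemiAnbd2006, Ex. 2.10 p.31] -/
theorem exists_continuousMulEquiv_map_cuspInertia_zero_eq_one (Sigma : Set ℕ) (g k : ℕ)
    (P : Type) [Group P] [TopologicalSpace P] [IsTopologicalGroup P] [CompactSpace P]
    [TotallyDisconnectedSpace P] (ι : PuncturedSurfaceGroup g (k + 2) →* P)
    (hι : SemiGraphOfAnabelioids.IsProSigmaCompletion Sigma ι) :
    ∃ τ : P ≃ₜ* P, τ (ι (PuncturedSurfaceGroup.c 0)) = ι (PuncturedSurfaceGroup.c 1) ∧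
      ((PuncturedSurfaceGroup.cuspInertia (g := g) (0 : Fin (k + 2))).map ι).topologicalClosure.map
          τ.toMulEquiv.toMonoidHom =
        ((PuncturedSurfaceGroup.cuspInertia (g := g) (1 : Fin (k + 2))).map ι).topologicalClosure := by
  -- the cusp-braiding automorphism `σ` of `Γ_{g,k+2}` with `σ c₀ = c₁`
  obtain ⟨e₁, -, -, he₁⟩ := PuncturedSurfaceGroup.exists_mulEquiv_freeGroup_elim_first g (k + 1)
  obtain ⟨e₂, -, -, he₂, -⟩ := PuncturedSurfaceGroup.exists_mulEquiv_freeGroup_elim_second g k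
  let σ : PuncturedSurfaceGroup g (k + 2) ≃* PuncturedSurfaceGroup g (k + 2) := e₂.trans e₁.symm
  have hσ : σ (PuncturedSurfaceGroup.c 0) = PuncturedSurfaceGroup.c 1 := by
    change e₁.symm (e₂ (PuncturedSurfaceGroup.c 0)) = _
    rw [he₂, ← he₁ 0, MulEquiv.symm_apply_apply]
    rfl
  -- extend `σ` to the completion
  obtain ⟨τ, hτ⟩ := hι.exists_continuousMulEquiv (hι.comp_mulEquiv σ)
  have hτc : τ (ι (PuncturedSurfaceGroup.c 0)) = ι (PuncturedSurfaceGroup.c 1) := by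
    rw [hτ, MonoidHom.comp_apply, MulEquiv.coe_toMonoidHom, hσ]
  refine ⟨τ, hτc, ?_⟩
  -- `τ(closure ι⟨c₀⟩) = closure τ(ι⟨c₀⟩) = closure ι⟨c₁⟩`
  apply SetLike.coe_injective
  rw [Subgroup.coe_map, Subgroup.topologicalClosure_coe, Subgroup.topologicalClosure_coe,
    Subgroup.coe_map, Subgroup.coe_map, MulEquiv.coe_toMonoidHom]
  change τ.toHomeomorph '' _ = _
  rw [τ.toHomeomorph.image_closure]
  congr 1
  change τ '' (ι '' _) = _
  rw [Set.image_image]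
  have h0 : (PuncturedSurfaceGroup.cuspInertia (g := g) (0 : Fin (k + 2)) :
      Set (PuncturedSurfaceGroup g (k + 2))) = Set.range fun n : ℤ => PuncturedSurfaceGroup.c 0 ^ n := by
    ext x; simp [PuncturedSurfaceGroup.cuspInertia, Subgroup.mem_zpowers_iff, eq_comm]
  have h1 : (PuncturedSurfaceGroup.cuspInertia (g := g) (1 : Fin (k + 2)) :
      Set (PuncturedSurfaceGroup g (k + 2))) = Set.range fun n : ℤ => PuncturedSurfaceGroup.c 1 ^ n := by
    ext x; simp [PuncturedSurfaceGroup.cuspInertia, Subgroup.mem_zpowers_iff, eq_comm]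
  rw [h0, h1, ← Set.range_comp, ← Set.range_comp]
  congr 1
  funext n
  simp only [Function.comp_apply, map_zpow, hτc]

/-- **A surface-type model with a LOOP, over a given pro-`Σ` completion** `ι : Γ_{g,k+2} → P`: the
dual semi-graph of a smooth `(k+2)`-pointed genus-`g` curve with its first two marked points
identified (one vertex with group `P`; one closed edge, a loop, with group `Ī₀` attached by the
inclusion and by `σ̂|Ī₀ : Ī₀ ⥲ Ī₁ ⊆ P`; `k` open edges with groups `Ī_{j+2}`) is of injective type,
connected, every edge abuts to the vertex, its node is a closed edge both of whose branches abut to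
the vertex, it is a graph when `k = 0`, and its semi-graph of anabelioids is of surface type
([SemiAnbd] Ex. 2.10, irreducible pointed stable curve with one node). [cite: MochizukiSemiAnbd2006, Ex. 2.10 p.31] -/
theorem exists_isOfSurfaceType_loop_of_isProSigmaCompletion (Sigma : Set ℕ)
    (hSigma : Sigma.Nonempty ∧ ∀ p ∈ Sigma, p.Prime) (g k : ℕ)
    (hgr : PuncturedSurfaceGroup.IsHyperbolicType g (k + 2)) (P : Type) [Group P]
    [TopologicalSpace P] [IsTopologicalGroup P] [CompactSpace P] [TotallyDisconnectedSpace P]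
    (ι : PuncturedSurfaceGroup g (k + 2) →* P)
    (hι : SemiGraphOfAnabelioids.IsProSigmaCompletion Sigma ι) :
    ∃ 𝔊 : ProfiniteSemiGraph.{0},
      Nonempty (𝔊.graph.Vertex ≃ Unit) ∧ Nonempty (𝔊.graph.Edge ≃ Option (Fin k)) ∧
        (∃ (e : 𝔊.graph.Edge) (v : 𝔊.graph.Vertex), 𝔊.graph.IsClosedEdge e ∧ 𝔊.graph.Joins e v v) ∧
        𝔊.toAnab.EveryEdgeAbuts ∧ 𝔊.toAnab.IsConnected ∧ 𝔊.IsOfInjectiveType ∧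
        (k = 0 → 𝔊.IsGraph) ∧
        (∀ v, Nonempty (𝔊.Gv v ≃ₜ* P) ∧ ∃ ιv : PuncturedSurfaceGroup g (k + 2) →* 𝔊.Gv v,
          SemiGraphOfAnabelioids.IsProSigmaCompletion Sigma ιv ∧
            ∃ js : 𝔊.graph.Star v → Fin (k + 2), Function.Injective js ∧ ∀ b : 𝔊.graph.Star v,
              𝔊.branchSubgroup b.1 v b.2 =
                ((PuncturedSurfaceGroup.cuspInertia (g := g) (js b)).map ιv).topologicalClosure) ∧
        𝔊.toAnab.IsOfSurfaceType Sigma := by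
  obtain ⟨τ, -, hτK⟩ := exists_continuousMulEquiv_map_cuspInertia_zero_eq_one Sigma g k P ι hι
  -- edge groups: the node `none` has group `Ī₀`, the open edge `j` has group `Ī_{j+2}`
  let cusp : Option (Fin k) → Fin (k + 2) := fun e => e.elim 0 fun j => j.succ.succ
  let K : Option (Fin k) → Subgroup P := fun e =>
    ((PuncturedSurfaceGroup.cuspInertia (g := g) (cusp e)).map ι).topologicalClosure
  haveI hKc : ∀ e, CompactSpace ↥(K e) := fun e =>
    isCompact_iff_compactSpace.mp (Subgroup.isClosed_topologicalClosure _).isCompact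
  -- the underlying semi-graph: branches `inl false`, `inl true` of the loop (both abutting to the
  -- vertex), `inr (inl j)` (abutting) and `inr (inr j)` (free) of the open edge `j`
  let Γ₀ : SemiGraph.{0} :=
    { Vertex := Unit
      Edge := Option (Fin k)
      Branch := Bool ⊕ (Fin k ⊕ Fin k)
      edgeOf := Sum.elim (fun _ => none) (Sum.elim some some)
      abuts := Sum.elim (fun _ => some ()) (Sum.elim (fun _ => some ()) fun _ => none)
      two_branches := by
        rintro (_ | j)
        · refine ⟨Sum.inl false, Sum.inl true, fun h => Bool.false_ne_true (Sum.inl_injective h),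
            rfl, rfl, ?_⟩
          rintro (i | j | j) hb
          · cases i
            · exact Or.inl rfl
            · exact Or.inr rfl
          · exact absurd hb (by simp)
          · exact absurd hb (by simp)
        · refine ⟨Sum.inr (Sum.inl j), Sum.inr (Sum.inr j), by simp, rfl, rfl, ?_⟩
          rintro (i | j' | j') hb
          · exact absurd hb (by simp)
          · left; simp only [Sum.elim_inr, Sum.elim_inl, Option.some.injEq] at hb; rw [hb]
          · right; simp only [Sum.elim_inr, Option.some.injEq] at hb; rw [hb] }
  -- the twist of a branch: `σ̂` on the second branch of the loop, the identity elsewhere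
  let tw : Γ₀.Branch → P ≃ₜ* P :=
    Sum.elim (fun i => cond i τ (ContinuousMulEquiv.refl P)) fun _ => ContinuousMulEquiv.refl P
  let 𝔊 : ProfiniteSemiGraph.{0} :=
    { graph := Γ₀
      Gv := fun _ => P
      Ge := fun e => ↥(K e)
      brHom := fun b _ _ =>
        { toMonoidHom := (tw b).toMulEquiv.toMonoidHom.comp (K (Γ₀.edgeOf b)).subtype
          continuous_toFun := (tw b).continuous.comp continuous_subtype_val } }
  have hbr : ∀ (b : 𝔊.graph.Branch) (v : 𝔊.graph.Vertex) (h : 𝔊.graph.abuts b = some v),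
      𝔊.branchSubgroup b v h = (K (Γ₀.edgeOf b)).map (tw b).toMulEquiv.toMonoidHom := by
    intro b v h
    change ((tw b).toMulEquiv.toMonoidHom.comp (K (Γ₀.edgeOf b)).subtype).range = _
    rw [MonoidHom.range_comp, Subgroup.range_subtype]
  -- the cusp of a branch at the vertex: `0`, `1` for the two branches of the loop, `j + 2` for the
  -- open edge `j`
  let js : ∀ v : 𝔊.graph.Vertex, 𝔊.graph.Star v → Fin (k + 2) := fun _ b =>
    Sum.elim (fun i => cond i 1 0) (Sum.elim (fun j => j.succ.succ) fun j => j.succ.succ) b.1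
  have hstar : ∀ (v : 𝔊.graph.Vertex) (b : 𝔊.graph.Star v),
      (∃ i : Bool, b.1 = Sum.inl i) ∨ ∃ j : Fin k, b.1 = Sum.inr (Sum.inl j) := by
    rintro v ⟨(i | j | j), hb⟩
    · exact Or.inl ⟨i, rfl⟩
    · exact Or.inr ⟨j, rfl⟩
    · exact absurd hb (by simp [𝔊, Γ₀])
  have hjs : ∀ v, Function.Injective (js v) := by
    intro v b b' h
    apply Subtype.ext
    rcases hstar v b with ⟨i, hb⟩ | ⟨j, hb⟩ <;> rcases hstar v b' with ⟨i', hb'⟩ | ⟨j', hb'⟩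
    · cases i <;> cases i'
      · rw [hb, hb']
      · exact absurd h (by simp [js, hb, hb'])
      · exact absurd h (by simp [js, hb, hb'])
      · rw [hb, hb']
    · cases i
      · exact absurd h (by simp [js, hb, hb', (Fin.succ_ne_zero _).symm])
      · exact absurd h (by
          simp only [js, hb, hb', Sum.elim_inl, Sum.elim_inr, cond_true]
          rw [← Fin.succ_zero_eq_one]
          exact fun h' => Fin.succ_ne_zero _ (Fin.succ_injective _ h').symm)
    · cases i'
      · exact absurd h (by simp [js, hb, hb', Fin.succ_ne_zero])
      · exact absurd h (by
          simp only [js, hb, hb', Sum.elim_inl, Sum.elim_inr, cond_true]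
          rw [← Fin.succ_zero_eq_one]
          exact fun h' => Fin.succ_ne_zero _ (Fin.succ_injective _ h'))
    · have hjj : j = j' := by simpa [js, hb, hb', Fin.succ_inj] using h
      rw [hb, hb', hjj]
  have hbs : ∀ (v : 𝔊.graph.Vertex) (b : 𝔊.graph.Star v),
      𝔊.branchSubgroup b.1 v b.2 =
        ((PuncturedSurfaceGroup.cuspInertia (g := g) (js v b)).map ι).topologicalClosure := by
    intro v b
    rw [hbr]
    rcases hstar v b with ⟨i, hb⟩ | ⟨j, hb⟩
    · cases i
      · -- first branch of the loop: the inclusion of `Ī₀`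
        simp only [hb, js, tw, Sum.elim_inl, cond_false]
        exact Subgroup.map_id _
      · -- second branch of the loop: `σ̂|Ī₀`, with image `Ī₁`
        simp only [hb, js, tw, Sum.elim_inl, cond_true]
        exact hτK
    · simp only [hb, js, tw, Sum.elim_inr, Sum.elim_inl]
      exact Subgroup.map_id _
  refine ⟨𝔊, ⟨Equiv.refl _⟩, ⟨Equiv.refl _⟩, ?_, ?_, ?_, ?_, ?_, ?_, ?_⟩
  · -- the loop is a closed edge joining the vertex to itself
    refine ⟨none, (), ?_, Sum.inl false, Sum.inl true,
      fun h => Bool.false_ne_true (Sum.inl_injective h), rfl, rfl, rfl, rfl⟩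
    have hvp : 𝔊.graph.verticialPortion none = {Sum.inl false, Sum.inl true} := by
      ext b
      simp only [SemiGraph.verticialPortion, Set.mem_setOf_eq, Set.mem_insert_iff,
        Set.mem_singleton_iff]
      constructor
      · rintro ⟨hb, -⟩
        rcases b with (i | j | j)
        · cases i
          · exact Or.inl rfl
          · exact Or.inr rfl
        · exact absurd hb (by simp [𝔊, Γ₀])
        · exact absurd hb (by simp [𝔊, Γ₀])
      · rintro (rfl | rfl) <;> exact ⟨rfl, rfl⟩
    change (𝔊.graph.verticialPortion none).ncard = 2
    rw [hvp]
    exact Set.ncard_pair fun h => Bool.false_ne_true (Sum.inl_injective h)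
  · -- every edge abuts to the vertex
    rintro (_ | j)
    · exact ⟨Sum.inl false, (), rfl, rfl⟩
    · exact ⟨Sum.inr (Sum.inl j), (), rfl, rfl⟩
  · -- connected
    exact ⟨𝔊.graph.isConnected_of_forall_edgeAbuts () (fun _ => rfl) fun e =>
      Option.rec ⟨Sum.inl false, rfl, rfl⟩ (fun j => ⟨Sum.inr (Sum.inl j), rfl, rfl⟩) e⟩
  · -- of injective type: automorphisms composed with subgroup inclusions
    intro b v h
    exact (tw b).injective.comp Subtype.val_injective
  · -- a graph when `k = 0`
    rintro rfl
    refine ⟨?_⟩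
    rintro (i | j | j)
    · rfl
    · exact j.elim0
    · exact j.elim0
  · -- the vertex groups and branch groups
    intro v
    exact ⟨⟨ContinuousMulEquiv.refl P⟩, ι, hι, js v, hjs v, hbs v⟩
  · -- of surface type, by the bridge
    refine 𝔊.isOfSurfaceType_toAnab Sigma hSigma
      (fun b v h => (tw b).injective.comp Subtype.val_injective) fun v =>
      ⟨g, k + 2, ι, hgr, hι, js v, hjs v, fun b => ⟨1, ?_⟩⟩
    rw [map_one, one_smul]
    exact hbs v b

/-- **Example 2.10 has a model WITH A LOOP**: for every nonempty set of primes `Σ` and hyperbolic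
`(g, k+2)`, the dual semi-graph of a smooth `(k+2)`-pointed genus-`g` curve with two marked points
identified (pro-`Σ` completion from `IsProSigmaCompletion.exists_isProSigmaCompletion`) is a
semi-graph of profinite groups of injective type, connected, with a closed edge both of whose branches
abut to its single vertex, every edge abutting to the vertex, a graph when `k = 0`, whose semi-graph of
anabelioids is of surface type. [cite: MochizukiSemiAnbd2006, Ex. 2.10 p.31] -/
theorem exists_isOfSurfaceType_loop (Sigma : Set ℕ) (hSigma : Sigma.Nonempty ∧ ∀ p ∈ Sigma, p.Prime)
    (g k : ℕ) (hgr : PuncturedSurfaceGroup.IsHyperbolicType g (k + 2)) :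
    ∃ 𝔊 : ProfiniteSemiGraph.{0},
      Nonempty (𝔊.graph.Vertex ≃ Unit) ∧ Nonempty (𝔊.graph.Edge ≃ Option (Fin k)) ∧
        (∃ (e : 𝔊.graph.Edge) (v : 𝔊.graph.Vertex), 𝔊.graph.IsClosedEdge e ∧ 𝔊.graph.Joins e v v) ∧
        𝔊.toAnab.EveryEdgeAbuts ∧ 𝔊.toAnab.IsConnected ∧ 𝔊.IsOfInjectiveType ∧
        (k = 0 → 𝔊.IsGraph) ∧
        (∀ v, ∃ ιv : PuncturedSurfaceGroup g (k + 2) →* 𝔊.Gv v,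
          SemiGraphOfAnabelioids.IsProSigmaCompletion Sigma ιv ∧
            ∃ js : 𝔊.graph.Star v → Fin (k + 2), Function.Injective js ∧ ∀ b : 𝔊.graph.Star v,
              𝔊.branchSubgroup b.1 v b.2 =
                ((PuncturedSurfaceGroup.cuspInertia (g := g) (js b)).map ιv).topologicalClosure) ∧
        𝔊.toAnab.IsOfSurfaceType Sigma := by
  obtain ⟨P, ι, hι⟩ := SemiGraphOfAnabelioids.IsProSigmaCompletion.exists_isProSigmaCompletion
    (PuncturedSurfaceGroup g (k + 2)) Sigma
  obtain ⟨𝔊, h1, h2, h3, h4, h5, h6, h7, h8, h9⟩ :=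
    exists_isOfSurfaceType_loop_of_isProSigmaCompletion Sigma hSigma g k hgr P ι hι
  exact ⟨𝔊, h1, h2, h3, h4, h5, h6, h7, fun v => (h8 v).2, h9⟩

end ProfiniteSemiGraph

/-- **A surface-type semi-graph of anabelioids with a loop** (§2 presentation): for every nonempty set
of primes `Σ` and hyperbolic `(g, k+2)` there is a connected semi-graph of anabelioids of surface type
with one vertex, a closed edge joining the vertex to itself and `k` further (open) edges, every edge
abutting to the vertex; for `k = 0` it is a graph of anabelioids ([SemiAnbd] Ex. 2.10, irreducible
pointed stable curve with one node). [cite: MochizukiSemiAnbd2006, Ex. 2.10 p.31] -/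
theorem SemiGraphOfAnabelioids.exists_isOfSurfaceType_loop (Sigma : Set ℕ)
    (hSigma : Sigma.Nonempty ∧ ∀ p ∈ Sigma, p.Prime) (g k : ℕ)
    (hgr : PuncturedSurfaceGroup.IsHyperbolicType g (k + 2)) :
    ∃ 𝒢 : SemiGraphOfAnabelioids.{0, 1, 0},
      𝒢.IsOfSurfaceType Sigma ∧ 𝒢.EveryEdgeAbuts ∧ 𝒢.IsConnected ∧
        Nonempty (𝒢.graph.Vertex ≃ Unit) ∧ Nonempty (𝒢.graph.Edge ≃ Option (Fin k)) ∧
        (∃ (e : 𝒢.graph.Edge) (v : 𝒢.graph.Vertex), 𝒢.graph.IsClosedEdge e ∧ 𝒢.graph.Joins e v v) ∧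
        (k = 0 → 𝒢.IsGraphOfAnabelioids) := by
  obtain ⟨𝔊, h1, h2, h3, h4, h5, -, h7, -, h9⟩ :=
    ProfiniteSemiGraph.exists_isOfSurfaceType_loop Sigma hSigma g k hgr
  exact ⟨𝔊.toAnab, h9, h4, h5, h1, h2, h3, fun hk => ⟨h7 hk⟩⟩

end Literature.AnabelianGeometry.SemiGraphs

end
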